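import Summits.CriticalPhenomena.PercolationContinuityZ3.Theorems.PercNearOneGluingNoHeavyLowerTailCubicThreePointTincInduction
import Mathlib.Tactic.Ring
import Mathlib.Tactic.Linarith
import Mathlib.Tactic.Positivity
import HarnessLib

/-!
# `NoHeavyLowerTail` (stmt-CriticalPhenomena-4575) — the apex-edge Bernstein pieces of `T_inc`: EVENT FORM and the reduction (TB1) ⟸ `T_inc` + (CAND1)

Support file (prover prim-l12-p6 gen 3, route-task `l12-p6`; `--supports stmt-CriticalPhenomena-4575`).  No definitions, no named facts,
no sorries: exact polynomial identities (`ring`) for the tree's `CubicThreePointStep.threeTB₁ / threeTB₂ / Tinc`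
(`…CubicThreePointTincInduction`) and their `linarith` corollaries.

VOCABULARY (as in `tinc_bernstein_expansion`): `x⁰ = (q,u₁,u₂,u₃,t)` the three-point cells of `(a,b,c)` in `G′ = G − e`, `e = {a,y}` the apex
edge, `σ = q+u₁+u₂+u₃+t`; transition masses of the gluing `a = y`: `α₁ (Q→ab|c) = μ(a|by|c)`, `α₂ (Q→ac|b) = μ(a|b|cy)`, `β₁ (ab|c→abc) = μ(ab|cy)`,
`β₂ (ac|b→abc) = μ(ac|by)`, `β₃ (bc|a→abc) = μ(a|bcy)`; `x¹ = (q−α₁−α₂, u₁+α₁−β₁, u₂+α₂−β₂, u₃−β₃, t+β₁+β₂+β₃)`.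
EVENT DICTIONARY (why the identities below are natural).  With `A = {a↔b}∪{a↔c}`, `B = {b↔a}∪{b↔c}`, `C = {c↔a}∪{c↔b}` in `G′` and their glued
versions `Aᵍ = A ∪ {y↔b or y↔c}`, `Bᵍ = B ∪ {b↔y}`, `Cᵍ = C ∪ {c↔y}` (the events of `T_inc` on `G′/{a=y}`), the masses are
`μ(A) = u₁+u₂+t`, `μ(B) = u₁+u₃+t`, `μ(C) = u₂+u₃+t`, and the INCREMENTS are `μ(Aᵍ∖A) = β₃+α₁+α₂`, `μ(Bᵍ∖B) = β₂+α₁`, `μ(Cᵍ∖C) = β₁+α₂`, with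
`μ((Aᵍ∖A)∩{b↔c}) = β₃`, `μ((Bᵍ∖B)∩C) = β₂`, `μ((Cᵍ∖C)∩B) = β₁`, `μ((Aᵍ∖A)∩(Bᵍ∖B)) = α₁`, `μ((Aᵍ∖A)∩(Cᵍ∖C)) = α₂`, `(Bᵍ∖B)∩(Cᵍ∖C) = ∅`.
Polarising the symmetric trilinear form of `T_inc = 2σ²μ(ABC) − σΣμ(A)μ(BC) + μ(A)μ(B)μ(C)` (one glued copy for `threeTB₁`, two for `threeTB₂`) gives

* `threeTB₁_event_form`:  `threeTB₁ = 2·T(x⁰) + T(x¹) + MID − SIG₂ − α′β′γ′`,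
* `threeTB₂_event_form`:  `threeTB₂ = T(x⁰) + 2·T(x¹) + MID − SIG₂ − 2·α′β′γ′`,
  where `α′ = β₃+α₁+α₂`, `β′ = β₂+α₁`, `γ′ = β₁+α₂`, `MID = σ·(α′(β₁+β₂) + β₃(β′+γ′) + 2β′γ′)`,
  `SIG₂ = α′β′(u₂+u₃+t) + α′(u₁+u₃+t)γ′ + (u₁+u₂+t)β′γ′`;
* `threeTB₁_sub_event_form` (the ttrl candidate `3·TB1 − TB0 − TB3`, request l.640 / cp-hms TINC-BERNSTEIN census: ratio `TB1/(TB0+TB3) ≥ 1/3` in all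
  230 M apex steps n ≤ 8):  `threeTB₁ − T(x⁰) − T(x¹) = T(x⁰) + σβ₃(β′+γ′) + β′γ′(2σ − (u₁+u₂+t) − α′) + α′(σ(β₁+β₂) − (u₂+u₃+t)β′ − (u₁+u₃+t)γ′)`
  — the ONLY negative contribution is `−α′((u₂+u₃+t)β′ + (u₁+u₃+t)γ′)`;
* `threeTB₁_nonneg_of_cand` : (TB1) follows from `T(x⁰) ≥ 0`, `T(x¹) ≥ 0` (instances of `T_inc`, a theorem: `TIncSwitching.tIncRow_holds`) and (CAND1);
  `threeTB₂_sub_threeTB₁` : `threeTB₂ − threeTB₁ = T(x¹) − T(x⁰) − α′β′γ′`.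
STATUS of the inequalities themselves (this seat, 2026-08-20, HOME = run/shared/lean/prim/prim-l12/prim-l12-p6/, FROM-prim-l12-p6-g3-TINC-BERNSTEIN.md):
(TB1), (TB2), (CAND1) have NO multiplier (Positivstellensatz) certificate over the α-free proved four-point dictionary (8 347 rows incl. the
cluster-Markov rows and the full vdBHK two-set family: strictly positive pseudo-laws), and ARE first-order consistent at all 40 cut-vertex face points once
the increasing row `α = E₃(U[a|bc],U[ab|c],U[acy|b])` (`AlphaRow`, machine-certified by prim-ineq-prove-3, Lean pending) is added; degree-5 LPs pending.
[folklore] (polarisation identities; algebra only)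
-/

namespace Summit.CriticalPhenomena.PercolationContinuityZ3.Theorems

namespace CubicThreePointStep

section Algebra

variable {R : Type*} [CommRing R]

/-- **Event form of `threeTB₁`** (one glued copy): `threeTB₁ = 2·T(x⁰) + T(x¹) + MID − SIG₂ − α′β′γ′` with `α′ = β₃+α₁+α₂`, `β′ = β₂+α₁`,
`γ′ = β₁+α₂` the masses of the increments `Aᵍ∖A, Bᵍ∖B, Cᵍ∖C`. [folklore] -/
theorem threeTB₁_event_form (q u₁ u₂ u₃ t α₁ α₂ β₁ β₂ β₃ : R) :
    threeTB₁ q u₁ u₂ u₃ t α₁ α₂ β₁ β₂ β₃ =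
      2 * Tinc q u₁ u₂ u₃ t + Tinc (q - α₁ - α₂) (u₁ + α₁ - β₁) (u₂ + α₂ - β₂) (u₃ - β₃) (t + β₁ + β₂ + β₃)
        + (q + u₁ + u₂ + u₃ + t) * ((β₃ + α₁ + α₂) * (β₁ + β₂) + β₃ * ((β₂ + α₁) + (β₁ + α₂)) + 2 * ((β₂ + α₁) * (β₁ + α₂)))
        - ((β₃ + α₁ + α₂) * (β₂ + α₁) * (u₂ + u₃ + t) + (β₃ + α₁ + α₂) * (u₁ + u₃ + t) * (β₁ + α₂)
            + (u₁ + u₂ + t) * (β₂ + α₁) * (β₁ + α₂))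
        - (β₃ + α₁ + α₂) * (β₂ + α₁) * (β₁ + α₂) := by
  simp only [threeTB₁, Tinc]
  ring

/-- **Event form of `threeTB₂`** (two glued copies): `threeTB₂ = T(x⁰) + 2·T(x¹) + MID − SIG₂ − 2·α′β′γ′`. [folklore] -/
theorem threeTB₂_event_form (q u₁ u₂ u₃ t α₁ α₂ β₁ β₂ β₃ : R) :
    threeTB₂ q u₁ u₂ u₃ t α₁ α₂ β₁ β₂ β₃ =
      Tinc q u₁ u₂ u₃ t + 2 * Tinc (q - α₁ - α₂) (u₁ + α₁ - β₁) (u₂ + α₂ - β₂) (u₃ - β₃) (t + β₁ + β₂ + β₃)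
        + (q + u₁ + u₂ + u₃ + t) * ((β₃ + α₁ + α₂) * (β₁ + β₂) + β₃ * ((β₂ + α₁) + (β₁ + α₂)) + 2 * ((β₂ + α₁) * (β₁ + α₂)))
        - ((β₃ + α₁ + α₂) * (β₂ + α₁) * (u₂ + u₃ + t) + (β₃ + α₁ + α₂) * (u₁ + u₃ + t) * (β₁ + α₂)
            + (u₁ + u₂ + t) * (β₂ + α₁) * (β₁ + α₂))
        - 2 * ((β₃ + α₁ + α₂) * (β₂ + α₁) * (β₁ + α₂)) := by
  simp only [threeTB₂, Tinc]
  ring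

/-- `threeTB₂ − threeTB₁ = T(x¹) − T(x⁰) − α′β′γ′`. [folklore] -/
theorem threeTB₂_sub_threeTB₁ (q u₁ u₂ u₃ t α₁ α₂ β₁ β₂ β₃ : R) :
    threeTB₂ q u₁ u₂ u₃ t α₁ α₂ β₁ β₂ β₃ - threeTB₁ q u₁ u₂ u₃ t α₁ α₂ β₁ β₂ β₃ =
      Tinc (q - α₁ - α₂) (u₁ + α₁ - β₁) (u₂ + α₂ - β₂) (u₃ - β₃) (t + β₁ + β₂ + β₃) - Tinc q u₁ u₂ u₃ t
        - (β₃ + α₁ + α₂) * (β₂ + α₁) * (β₁ + α₂) := by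
  simp only [threeTB₁, threeTB₂, Tinc]
  ring

/-- **Event form of the ttrl candidate `3·TB1 − TB0 − TB3`**:
`threeTB₁ − T(x⁰) − T(x¹) = T(x⁰) + σβ₃(β′+γ′) + β′γ′(2σ − μ(A) − α′) + α′(σ(β₁+β₂) − μ(C)β′ − μ(B)γ′)`;
all terms but the last product are nonnegative on realizable laws (`2σ − μ(A) − α′ = σ + μ(Aᵍᶜ) ≥ σ`). [folklore] -/
theorem threeTB₁_sub_event_form (q u₁ u₂ u₃ t α₁ α₂ β₁ β₂ β₃ : R) :
    threeTB₁ q u₁ u₂ u₃ t α₁ α₂ β₁ β₂ β₃ - Tinc q u₁ u₂ u₃ t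
        - Tinc (q - α₁ - α₂) (u₁ + α₁ - β₁) (u₂ + α₂ - β₂) (u₃ - β₃) (t + β₁ + β₂ + β₃) =
      Tinc q u₁ u₂ u₃ t + (q + u₁ + u₂ + u₃ + t) * β₃ * ((β₂ + α₁) + (β₁ + α₂))
        + (β₂ + α₁) * (β₁ + α₂) * (2 * (q + u₁ + u₂ + u₃ + t) - (u₁ + u₂ + t) - (β₃ + α₁ + α₂))
        + (β₃ + α₁ + α₂) * ((q + u₁ + u₂ + u₃ + t) * (β₁ + β₂) - (u₂ + u₃ + t) * (β₂ + α₁) - (u₁ + u₃ + t) * (β₁ + α₂)) := by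
  simp only [threeTB₁, Tinc]
  ring

end Algebra

/-- **(TB1) from `T_inc` and (CAND1).**  If `T(x⁰) ≥ 0`, `T(x¹) ≥ 0` (two instances of the theorem `T_inc ≥ 0`) and the candidate
`3·TB1 − TB0 − TB3 ≥ 0` holds, then `threeTB₁ ≥ 0`. [folklore] -/
theorem threeTB₁_nonneg_of_cand {q u₁ u₂ u₃ t α₁ α₂ β₁ β₂ β₃ : ℝ}
    (h₀ : 0 ≤ Tinc q u₁ u₂ u₃ t)
    (h₃ : 0 ≤ Tinc (q - α₁ - α₂) (u₁ + α₁ - β₁) (u₂ + α₂ - β₂) (u₃ - β₃) (t + β₁ + β₂ + β₃))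
    (hc : 0 ≤ threeTB₁ q u₁ u₂ u₃ t α₁ α₂ β₁ β₂ β₃ - Tinc q u₁ u₂ u₃ t
        - Tinc (q - α₁ - α₂) (u₁ + α₁ - β₁) (u₂ + α₂ - β₂) (u₃ - β₃) (t + β₁ + β₂ + β₃)) :
    0 ≤ threeTB₁ q u₁ u₂ u₃ t α₁ α₂ β₁ β₂ β₃ := by
  linarith

/-- **(CAND1) from its event form.**  With nonnegative cells and transition masses, `σ ≥ μ(A) + α′` (i.e. `μ(Aᵍ) ≤ σ`, automatic on realizable
laws) every term of the event form except the last is nonnegative, so the single CORE inequality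
`α′(μ(C)β′ + μ(B)γ′) ≤ T(x⁰) + σβ₃(β′+γ′) + β′γ′(2σ − μ(A) − α′) + α′σ(β₁+β₂)` (hypothesis `hcore`) is exactly the candidate
`3·TB1 − TB0 − TB3 ≥ 0` rearranged.  (This only isolates what a proof of (CAND1) has to show; `hcore` is NOT proved here.) [folklore] -/
theorem cand_nonneg_of_core {q u₁ u₂ u₃ t α₁ α₂ β₁ β₂ β₃ : ℝ}
    (hcore : (β₃ + α₁ + α₂) * ((u₂ + u₃ + t) * (β₂ + α₁) + (u₁ + u₃ + t) * (β₁ + α₂)) ≤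
        Tinc q u₁ u₂ u₃ t + (q + u₁ + u₂ + u₃ + t) * β₃ * ((β₂ + α₁) + (β₁ + α₂))
          + (β₂ + α₁) * (β₁ + α₂) * (2 * (q + u₁ + u₂ + u₃ + t) - (u₁ + u₂ + t) - (β₃ + α₁ + α₂))
          + (β₃ + α₁ + α₂) * ((q + u₁ + u₂ + u₃ + t) * (β₁ + β₂))) :
    0 ≤ threeTB₁ q u₁ u₂ u₃ t α₁ α₂ β₁ β₂ β₃ - Tinc q u₁ u₂ u₃ t
        - Tinc (q - α₁ - α₂) (u₁ + α₁ - β₁) (u₂ + α₂ - β₂) (u₃ - β₃) (t + β₁ + β₂ + β₃) := by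
  rw [threeTB₁_sub_event_form]
  nlinarith [hcore]

end CubicThreePointStep

end Summit.CriticalPhenomena.PercolationContinuityZ3.Theorems
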